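import Literature.AlgebraicGeometry.Motives.AbelianVarietyCotangent
import HarnessLib

/-!
# The cotangent map of a homomorphism of abelian varieties

Let `f : A → B` be a homomorphism of abelian varieties over a field `K`, with origins `e_A`, `e_B`
and local rings `𝒪_{A,e_A}`, `𝒪_{B,e_B}` (`AbelianVariety.stalkOrigin`). Since `f(e_A) = e_B`
(`AbelianVariety.toSchemeHom_origin`), `f` induces a local `K`-algebra homomorphism
`f^* : 𝒪_{B,e_B} → 𝒪_{A,e_A}` and hence a `K`-linear map of cotangent spaces
`f^* : 𝔪_{e_B}/𝔪_{e_B}² → 𝔪_{e_A}/𝔪_{e_A}²` — the transpose of the tangent map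
`T_e(f) : T_{e_A} A → T_{e_B} B` (Görtz–Wedhorn I, Remark 6.3 (3); Görtz–Wedhorn II, Def. 27.17,
Rem. 27.18 (1)). This file provides

* `AbelianVariety.Hom.stalkMapOrigin f : stalkOrigin B ⟶ stalkOrigin A` — the stalk map of `f` at
  `e_A`, transported along `f(e_A) = e_B`; for an endomorphism it is `AbelianVariety.stalkMapEnd`
  (`stalkMapEnd_eq_stalkMapOrigin`, by `rfl`);
* `AbelianVariety.Hom.cotangentMap f : Cotangent B →ₗ[K] Cotangent A` — the induced map on
  `𝔪_e/𝔪_e²`; for an endomorphism it is `AbelianVariety.cotangentMap` (`cotangentMap_eq_hom_cotangentMap`,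
  by `rfl`);
* contravariant functoriality `(g ∘ f)^* = f^* ∘ g^*`, `𝟙^* = id` (`Hom.stalkMapOrigin_comp/_id`,
  `Hom.cotangentMap_comp/_id`), the cotangent `K`-linear equivalence of an isomorphism
  (`AbelianVariety.cotangentEquivOfIso`), and `0^* = 0` for the zero homomorphism `A → B`
  (`Hom.cotangentMap_zero`, from the endomorphism case `AbelianVariety.cotangentMap_zero` and
  `0 = 0_A ≫ 0`).

This is the hom-version («S2») of the endomorphism-only API of `Motives/AbelianVarietyCotangent`,
needed to state «the tangent map of `λ̃ : Ã → B̃` vanishes» for a homomorphism between two different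
abelian varieties (Shimura, *Abelian Varieties with Complex Multiplication* (1998), §2.8 Prop. 6 and
§13.1, proof of Thm. 1 on p. 129: `δλ̃ = 0 ⇒ λ̃` factors through the Frobenius). Everything is proved;
there are no named facts; the two definitions are Mathlib's `Scheme.Hom.stalkMap` /
`Ideal.mapCotangent` specialised to the origins, exactly as in the endomorphism case.

## Design notes

* As in `Motives/AbelianVarietyCotangent`, the `K`-algebra structures `stalkOriginAlgebraMap A`,
  `stalkOriginAlgebraMap B` are used only through local `letI`, never as global instances; no new
  instances are declared (the local-homomorphism property of `f^*` is the theorem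
  `Hom.isLocalHom_stalkMapOrigin`, used via `haveI`).
* Additivity `(f + g)^* = f^* + g^*` for `f g : A → B` is not needed by the consumers and is not
  ported here (the endomorphism case is `AbelianVariety.cotangentMap_add`).
* Mathlib searched and used: `TopCat.Presheaf.stalkCongr`, `TopCat.Presheaf.germ_stalkSpecializes`,
  `Scheme.Hom.germ_stalkMap(_apply)`, `TopCat.Presheaf.stalk_hom_ext`, `Ideal.mapCotangent`,
  `LinearEquiv.ofLinear`, `Limits.zero_comp`.

## References

* [GortzWedhorn2020] U. Görtz, T. Wedhorn, *Algebraic Geometry I* (2nd ed., 2020): Def. 6.2,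
  Remark 6.3 (3).
* [GortzWedhorn2023] U. Görtz, T. Wedhorn, *Algebraic Geometry II* (2023): Def. 27.17,
  Rem. 27.18 (1) (pp. 805–806).
* [Shimura1998] G. Shimura, *Abelian Varieties with Complex Multiplication and Modular Functions*
  (1998), §2.8 Prop. 6, §13.1 (p. 129).
-/

universe u

open CategoryTheory CategoryTheory.Limits AlgebraicGeometry

noncomputable section

namespace Literature.AlgebraicGeometry.Motives

namespace AbelianVariety

variable {K : Type u} [Field K] {A B C : AbelianVariety K}

/-! ### The stalk map `f^* : 𝒪_{B,e_B} → 𝒪_{A,e_A}` of a homomorphism -/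

/-- **The local homomorphism of `f : A → B` at the origins**, `f^* : 𝒪_{B,e_B} → 𝒪_{A,e_A}`: the
stalk map of `f` at `e_A`, transported along `f(e_A) = e_B` (Görtz–Wedhorn I, Remark 6.3 (3):
`f_x^♯ : 𝒪_{Y,f(x)} → 𝒪_{X,x}`; Görtz–Wedhorn II, Rem. 27.18 (1)). For an endomorphism this is
`stalkMapEnd` (`stalkMapEnd_eq_stalkMapOrigin`). [cite: GortzWedhorn2020, Remark 6.3 (3)] -/
def Hom.stalkMapOrigin (f : A ⟶ B) : stalkOrigin B ⟶ stalkOrigin A :=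
  (B.X.left.presheaf.stalkCongr (.of_eq (toSchemeHom_origin f))).inv ≫
    (Hom.toSchemeHom f).stalkMap (origin A)

/-- For an endomorphism `u : A → A`, `stalkMapEnd A u` is `Hom.stalkMapOrigin u` (same construction).
[cite: GortzWedhorn2020, Remark 6.3 (3)] -/
theorem stalkMapEnd_eq_stalkMapOrigin (u : A ⟶ A) : stalkMapEnd A u = Hom.stalkMapOrigin u := rfl

/-- `f^*` on germs: `f^*(s_{e_B}) = (f^♯ s)_{e_A}` for a section `s` of `B` near the origin
(Görtz–Wedhorn I, Remark 6.3 (3)). [cite: GortzWedhorn2020, Remark 6.3 (3)] -/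
@[reassoc]
theorem Hom.germ_stalkMapOrigin (f : A ⟶ B) (U : B.X.left.Opens) (hU : origin B ∈ U) :
    B.X.left.presheaf.germ U (origin B) hU ≫ Hom.stalkMapOrigin f =
      (Hom.toSchemeHom f).app U ≫ A.X.left.presheaf.germ ((Hom.toSchemeHom f) ⁻¹ᵁ U) (origin A)
        (show (Hom.toSchemeHom f).base (origin A) ∈ U by rwa [toSchemeHom_origin]) := by
  rw [Hom.stalkMapOrigin, TopCat.Presheaf.stalkCongr_inv,
    TopCat.Presheaf.germ_stalkSpecializes_assoc, Scheme.Hom.germ_stalkMap]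

/-- **`(g ∘ f)^* = f^* ∘ g^*`**: the stalk map at the origins is contravariantly functorial
(Görtz–Wedhorn I, Remark 6.3 (3): "compatible with composition of morphisms").
[cite: GortzWedhorn2020, Remark 6.3 (3)] -/
theorem Hom.stalkMapOrigin_comp (f : A ⟶ B) (g : B ⟶ C) :
    Hom.stalkMapOrigin (f ≫ g) = Hom.stalkMapOrigin g ≫ Hom.stalkMapOrigin f := by
  apply TopCat.Presheaf.stalk_hom_ext
  intro U hU
  rw [Hom.germ_stalkMapOrigin, Hom.germ_stalkMapOrigin_assoc, Hom.germ_stalkMapOrigin,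
    ← Category.assoc]
  congr 1

/-- `(𝟙_A)^* = id` (Görtz–Wedhorn I, Remark 6.3 (3)). [cite: GortzWedhorn2020, Remark 6.3 (3)] -/
theorem Hom.stalkMapOrigin_id : Hom.stalkMapOrigin (𝟙 A) = 𝟙 (stalkOrigin A) :=
  AbelianVariety.stalkMapEnd_id

/-- `f^*` is a local homomorphism (a stalk map of a morphism of schemes composed with an
isomorphism of stalks). [cite: GortzWedhorn2020, Remark 6.3 (3)] -/
theorem Hom.isLocalHom_stalkMapOrigin (f : A ⟶ B) : IsLocalHom (Hom.stalkMapOrigin f).hom := by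
  unfold Hom.stalkMapOrigin
  rw [CommRingCat.hom_comp]
  infer_instance

/-- `f^*` is `K`-linear: `f^*` carries the image of `K` in `𝒪_{B,e_B}` to the image of `K` in
`𝒪_{A,e_A}` (`f` is a `K`-morphism: `f ≫ (B → Spec K) = (A → Spec K)`). [cite: GortzWedhorn2020, Remark 6.3 (3)] -/
theorem Hom.stalkMapOrigin_algebraMap (f : A ⟶ B) (c : K) :
    Hom.stalkMapOrigin f (stalkOriginAlgebraMap B c) = stalkOriginAlgebraMap A c := by
  rw [stalkOriginAlgebraMap_apply, stalkOriginAlgebraMap_apply, Hom.stalkMapOrigin,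
    CommRingCat.comp_apply]
  have h1 : (B.X.left.presheaf.stalkCongr (.of_eq (toSchemeHom_origin f))).inv
        (B.X.left.presheaf.germ ⊤ (origin B) trivial
          (B.X.hom.appTop ((Scheme.ΓSpecIso (.of K)).inv c))) =
      B.X.left.presheaf.germ ⊤ ((Hom.toSchemeHom f).base (origin A)) trivial
        (B.X.hom.appTop ((Scheme.ΓSpecIso (.of K)).inv c)) := by
    rw [TopCat.Presheaf.stalkCongr_inv]
    exact TopCat.Presheaf.germ_stalkSpecializes_apply _ _ _ _
  rw [h1, Scheme.Hom.germ_stalkMap_apply]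
  exact congrArg (fun g : A.X.left ⟶ Spec (.of K) =>
    A.X.left.presheaf.germ ⊤ (origin A) trivial (g.appTop ((Scheme.ΓSpecIso (.of K)).inv c)))
    (toSchemeHom_comp_hom f)

/-- `f^*` maps `𝔪_{e_B}` into `𝔪_{e_A}`. [cite: GortzWedhorn2020, Remark 6.3 (3)] -/
theorem Hom.stalkMapOrigin_mem (f : A ⟶ B) {x : stalkOrigin B}
    (hx : x ∈ IsLocalRing.maximalIdeal (stalkOrigin B)) :
    Hom.stalkMapOrigin f x ∈ IsLocalRing.maximalIdeal (stalkOrigin A) :=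
  haveI := Hom.isLocalHom_stalkMapOrigin f
  map_nonunit (Hom.stalkMapOrigin f).hom x hx

/-! ### The cotangent map `f^* : 𝔪_{e_B}/𝔪_{e_B}² → 𝔪_{e_A}/𝔪_{e_A}²` -/

/-- **The cotangent map of a homomorphism `f : A → B`**: the `K`-linear map
`𝔪_{e_B}/𝔪_{e_B}² → 𝔪_{e_A}/𝔪_{e_A}²` induced by `f^* : 𝒪_{B,e_B} → 𝒪_{A,e_A}` — the transpose of
the tangent map `T_e(f)` (Görtz–Wedhorn I, Remark 6.3 (3); Görtz–Wedhorn II, Def. 27.17,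
Rem. 27.18 (1)). It is Mathlib's `Ideal.mapCotangent` of the `K`-algebra map `f^*`; for an
endomorphism it is `cotangentMap A` (`cotangentMap_eq_hom_cotangentMap`).
[cite: GortzWedhorn2020, Remark 6.3 (3)] -/
def Hom.cotangentMap (f : A ⟶ B) : Cotangent B →ₗ[K] Cotangent A :=
  letI : Algebra K (stalkOrigin A) := (stalkOriginAlgebraMap A).toAlgebra
  letI : Algebra K (stalkOrigin B) := (stalkOriginAlgebraMap B).toAlgebra
  Ideal.mapCotangent (IsLocalRing.maximalIdeal (stalkOrigin B))
    (IsLocalRing.maximalIdeal (stalkOrigin A))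
    ({ (Hom.stalkMapOrigin f).hom with commutes' := Hom.stalkMapOrigin_algebraMap f } :
      stalkOrigin B →ₐ[K] stalkOrigin A)
    (fun _ hx => Hom.stalkMapOrigin_mem f hx)

/-- For an endomorphism `u : A → A`, `cotangentMap A u` is `Hom.cotangentMap u` (same construction).
[cite: GortzWedhorn2020, Remark 6.3 (3)] -/
theorem cotangentMap_eq_hom_cotangentMap (u : A ⟶ A) : cotangentMap A u = Hom.cotangentMap u := rfl

/-- The cotangent map on classes: `f^*(ā)` is the class of `f^*(a)` (Görtz–Wedhorn I, Remark 6.3 (3):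
the map `𝔪_{f(x)}/𝔪_{f(x)}² → 𝔪_x/𝔪_x²` induced by `f_x^♯`). [cite: GortzWedhorn2020, Remark 6.3 (3)] -/
@[simp]
theorem Hom.cotangentMap_mk (f : A ⟶ B) (a : IsLocalRing.maximalIdeal (stalkOrigin B)) :
    Hom.cotangentMap f (Cotangent.mk B a) =
      Cotangent.mk A ⟨Hom.stalkMapOrigin f a, Hom.stalkMapOrigin_mem f a.2⟩ :=
  rfl

/-- **`(g ∘ f)^* = f^* ∘ g^*` on cotangent spaces** (Görtz–Wedhorn I, Remark 6.3 (3); Görtz–Wedhorn II,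
Rem. 27.18 (1): functoriality of `T_e`). [cite: GortzWedhorn2020, Remark 6.3 (3)] -/
theorem Hom.cotangentMap_comp (f : A ⟶ B) (g : B ⟶ C) :
    Hom.cotangentMap (f ≫ g) = Hom.cotangentMap f ∘ₗ Hom.cotangentMap g := by
  apply LinearMap.ext
  intro x
  obtain ⟨a, rfl⟩ := Cotangent.mk_surjective x
  simp only [LinearMap.comp_apply, Hom.cotangentMap_mk, Hom.stalkMapOrigin_comp,
    CommRingCat.comp_apply]

/-- `(𝟙_A)^* = id` on `𝔪_e/𝔪_e²` (Görtz–Wedhorn I, Remark 6.3 (3)). [cite: GortzWedhorn2020, Remark 6.3 (3)] -/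
theorem Hom.cotangentMap_id : Hom.cotangentMap (𝟙 A) = LinearMap.id :=
  AbelianVariety.cotangentMap_id

/-- For an isomorphism `e : A ≅ B`, `(e.hom)^* ∘ (e.inv)^* = id` on `𝔪_{e_A}/𝔪_{e_A}²` (functoriality).
[cite: GortzWedhorn2020, Remark 6.3 (3)] -/
theorem Hom.cotangentMap_hom_comp_inv (e : A ≅ B) :
    Hom.cotangentMap e.hom ∘ₗ Hom.cotangentMap e.inv = LinearMap.id := by
  rw [← Hom.cotangentMap_comp, Iso.hom_inv_id, Hom.cotangentMap_id]

/-- For an isomorphism `e : A ≅ B`, `(e.inv)^* ∘ (e.hom)^* = id` on `𝔪_{e_B}/𝔪_{e_B}²` (functoriality).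
[cite: GortzWedhorn2020, Remark 6.3 (3)] -/
theorem Hom.cotangentMap_inv_comp_hom (e : A ≅ B) :
    Hom.cotangentMap e.inv ∘ₗ Hom.cotangentMap e.hom = LinearMap.id := by
  rw [← Hom.cotangentMap_comp, Iso.inv_hom_id, Hom.cotangentMap_id]

/-- **The cotangent spaces of isomorphic abelian varieties are isomorphic**: for `e : A ≅ B`, the
`K`-linear equivalence `𝔪_{e_B}/𝔪_{e_B}² ≃ 𝔪_{e_A}/𝔪_{e_A}²` given by `(e.hom)^*` with inverse
`(e.inv)^*` (functoriality, Görtz–Wedhorn I, Remark 6.3 (3)). [cite: GortzWedhorn2020, Remark 6.3 (3)] -/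
def cotangentEquivOfIso (e : A ≅ B) : Cotangent B ≃ₗ[K] Cotangent A :=
  LinearEquiv.ofLinear (Hom.cotangentMap e.hom) (Hom.cotangentMap e.inv)
    (Hom.cotangentMap_hom_comp_inv e) (Hom.cotangentMap_inv_comp_hom e)

/-- The equivalence `cotangentEquivOfIso e` is `(e.hom)^*`. [cite: GortzWedhorn2020, Remark 6.3 (3)] -/
@[simp]
theorem cotangentEquivOfIso_apply (e : A ≅ B) (x : Cotangent B) :
    cotangentEquivOfIso e x = Hom.cotangentMap e.hom x := rfl

/-- The inverse of `cotangentEquivOfIso e` is `(e.inv)^*`. [cite: GortzWedhorn2020, Remark 6.3 (3)] -/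
@[simp]
theorem cotangentEquivOfIso_symm_apply (e : A ≅ B) (x : Cotangent A) :
    (cotangentEquivOfIso e).symm x = Hom.cotangentMap e.inv x := rfl

/-- Isomorphic abelian varieties have cotangent spaces of the same dimension (both equal to the
common dimension; here directly from `cotangentEquivOfIso`). [cite: GortzWedhorn2020, Remark 6.3 (3)] -/
theorem finrank_cotangent_eq_of_iso (e : A ≅ B) :
    Module.finrank K (Cotangent B) = Module.finrank K (Cotangent A) :=
  (cotangentEquivOfIso e).finrank_eq

/-- **`0^* = 0`** for the zero homomorphism `0 : A → B` (it factors through `Spec K`, whose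
cotangent space vanishes; here from `0 = 0_A ≫ 0` and the endomorphism case
`cotangentMap_zero : (0 : A → A)^* = 0`, Görtz–Wedhorn II, Rem. 27.18 (3)).
[cite: GortzWedhorn2023, Rem. 27.18 (3) (p. 806)] -/
theorem Hom.cotangentMap_zero : Hom.cotangentMap (0 : A ⟶ B) = 0 := by
  rw [← zero_comp (X := A) (Y := A) (f := (0 : A ⟶ B)), Hom.cotangentMap_comp,
    ← cotangentMap_eq_hom_cotangentMap, AbelianVariety.cotangentMap_zero, LinearMap.zero_comp]

/-- A homomorphism that factors as `f = g ≫ h` with `g^* = 0` or `h^* = 0` has `f^* = 0`; in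
particular `(f ≫ 0)^* = 0` and `(0 ≫ f)^* = 0`. Recorded in the form used downstream:
`(g ≫ h)^* = 0` when `h^* = 0`. [cite: GortzWedhorn2020, Remark 6.3 (3)] -/
theorem Hom.cotangentMap_comp_eq_zero_of_right (g : A ⟶ B) (h : B ⟶ C)
    (hh : Hom.cotangentMap h = 0) : Hom.cotangentMap (g ≫ h) = 0 := by
  rw [Hom.cotangentMap_comp, hh, LinearMap.comp_zero]

/-- `(g ≫ h)^* = 0` when `g^* = 0`. [cite: GortzWedhorn2020, Remark 6.3 (3)] -/
theorem Hom.cotangentMap_comp_eq_zero_of_left (g : A ⟶ B) (h : B ⟶ C)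
    (hg : Hom.cotangentMap g = 0) : Hom.cotangentMap (g ≫ h) = 0 := by
  rw [Hom.cotangentMap_comp, hg, LinearMap.zero_comp]

end AbelianVariety

end Literature.AlgebraicGeometry.Motives
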